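import Summits.HodgeConjecture.HodgeConjecture.Theorems.F0P2cStubCLLocalTypeExists
import Summits.HodgeConjecture.HodgeConjecture.Theorems.F0P2cStubCI
import Summits.HodgeConjecture.HodgeConjecture.Theorems.P2StubCFOfLocal
import Literature.NumberTheory.Rogawski1990.CohomologicalFinComponentIsTheta
import Literature.RepresentationTheory.Liu2021.GlobalOscillatorIsomorphismCriterion
import HarnessLib

/-!
# FLOOR-0 P2, (C)-line `Cruxes/H413/Lines/F0_P2CohFinComponentIsThetaC.lean` (crux item stmt-HodgeConjecture-24833 `HCCMUnconditional.H413`):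
# THE SOCKET IMPLIES THE LETTER — `CE ⟸ (C♭)` (and hence `CE ⟸ (C)`)

Cell hodgecm-mathlib (D-0151), FLOOR 0, programme P2; seat F0P2-p03 (g3) on the P2 desk's last in-house row (F0P2-plan (g3) desk word
2026-08-31T01:45:23Z).  THEOREMS ONLY (no `def`, no instance, no notation, no named fact, no `sorry`); never imports a `Cruxes/…/Lines` module
(s347 ∕ s380b): the two registered bodies are RESTATED VERBATIM — the hypothesis is the (C♭) text `CohFinComponentIsThetaAdm` ((C)-line v1.2
259a62f4 :111–143) and the conclusion is the CE text `StubCELocalTypesTheta` (:217–251) with the Lines-local bundle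
`IsLocalTypeAt F E c N J ρ v τ := τ.IsIrreducible ∧ isotypicComponent ℂ[U(J)(F_v)] (ρ.comp (inclPlace v)).asModule τ.asModule = ⊤` δ-unfolded
(the same unfolded CE text as the `hCE` binder of ★ `F0P2cSocketCOfStubs.cohFinComponentIsThetaAdm_of_CE_CF_CI`, p800266).

WHY (F0P2-plan (g3) 01:45:23Z): ★ `F0P2cSocketCOfStubs.cohFinComponentIsThetaAdm_of_CE_CF_CI` gives (C♭) ⟸ CE ∧ CF ∧ CI, and CF (★ p801844
`P2StubCFFlathRigidity.stubCF_holds`), CI (★ p800717 `F0P2cStubCI.stubCI_holds`), CL (★ p799835 `F0P2cStubCLLocalTypeExists.stubCL_holds`) are theorems;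
this file gives the converse **CE ⟸ (C♭)**, so on the floor **CE ⟺ (C♭)** is kernel-checked: the ENGINE-INTERFACES (C)-row may be delivered in
EITHER currency (a global equivariant embedding `σ ↪ ω_H`, or place-by-place local types) and the refuter's «is the letter CE secretly stronger
than the socket?» is answered NO.

PROOF (pure isotypic calculus; [Bump1997, §3.4 Prop. 3.4.1 last bullet], [FlathCorvallis1979, Thm. 3 uniqueness clause]).  (C♭) hands the
global datum `(μ, a, χ)` and an injective intertwiner `f : σ → ω_H`; keep the same `(μ, a, χ)`.  Fix a finite place `v` and an irreducible `τ`
with `σ|_{U(H)(L⁺_v)}` `τ`-isotypic (`= ⊤`).  By CI ★ `ω_H` is irreducible admissible, so CL ★ gives an irreducible `τ′` with `ω_H|_{U(H)(L⁺_v)}`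
`τ′`-isotypic.  `f` restricted along ★ `inclPlace v` is an injective `ℂ[U(H)(L⁺_v)]`-intertwiner, so `σ|_v` is ALSO `τ′`-isotypic (★
`P2StubCFOfLocal.isotypicComponent_eq_top_of_injective`, Mathlib `IsIsotypicOfType.of_injective`); `σ ≠ 0` (irreducible), hence `τ ≃ τ′` as
`ℂ[U(H)(L⁺_v)]`-modules (★ `Liu2021.nonempty_linearEquiv_of_isotypicComponent_eq_top` — the isotypic type of a non-zero module is unique), and
`isotypicComponent (ω_H|_v) τ = isotypicComponent (ω_H|_v) τ′ = ⊤` (Mathlib `LinearEquiv.isotypicComponent_eq`).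

* `stubCE_of_cohFinComponentIsThetaAdm : ‹(C♭)› → ‹CE›` — THE ROW.
* `stubCE_of_cohFinComponent_isTheta : Literature.NumberTheory.Rogawski1990.cohFinComponent_isTheta → ‹CE›` — from the Literature socket (C)
  itself ((C) ⇒ (C♭) drops the admissibility binder).

Imports: ★ `Theorems.F0P2cStubCLLocalTypeExists` (CL), ★ `Theorems.F0P2cStubCI` (CI), ★ `Theorems.P2StubCFOfLocal` (pull-back of isotypy along an
injective intertwiner), ★ `Literature/NumberTheory/Rogawski1990/CohomologicalFinComponentIsTheta` (the socket (C) and its vocabulary), ★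
`Literature/RepresentationTheory/Liu2021/GlobalOscillatorIsomorphismCriterion` (type uniqueness).  Cone-check (U284): none of them is on
`director/F0/reg/R2-reverse-cone.directorg14.txt`.  `--supports stmt-HodgeConjecture-24833 --as helper`.
HC_CM is proved only modulo the printed citations until rung 0 closes; this file discharges none of them (CE stays the engine letter).

## References
* [Bump1997] D. Bump, *Automorphic Forms and Representations*, Cambridge Stud. Adv. Math. 55 (1997), §3.4 Prop. 3.4.1, Thm. 3.4.4.
* [FlathCorvallis1979] D. Flath, Decomposition of representations into tensor products, PSPM 33.1 (1979), Thm. 3.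
* [Rogawski1990] J. Rogawski, Ann. of Math. Stud. 123, Thm. 13.3.6 (c).  [Liu2021] Y. Liu, Camb. J. Math. 9 (2021), Def. 4.11, Rem. 4.14, App. D Lem. D.1.
-/

set_option autoImplicit false
-- the mandated namespace has the single-problem summit's repeated segment (`HodgeConjecture.HodgeConjecture`)
set_option linter.dupNamespace false

noncomputable section

namespace Summit.HodgeConjecture.HodgeConjecture.Cruxes.H413.F0P2cStubCEOfSocketCadm

open NumberField MeasureTheory IsDedekindDomain
open scoped Matrix ComplexOrder
open Literature.NumberTheory.Automorphic Literature.NumberTheory.Automorphic.UnitaryGroup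
open Literature.NumberTheory.Automorphic.UnitaryGroup.CotangentForms
open Literature.NumberTheory.Automorphic.IdeleClassGroup
open Literature.NumberTheory.Automorphic.Liu2021 Literature.NumberTheory.Automorphic.Liu2021.Def411WeilCarriers
open Literature.NumberTheory.Automorphic.Liu2021.Def411WeilCarriersDoubling
open Literature.NumberTheory.GelbartRogawski1991 Literature.NumberTheory.GelbartRogawski1991.UnitaryDualPair
open Literature.RepresentationTheory.Liu2021
open Literature.NumberTheory.Rogawski1990

/-! ## §1  CE ⟸ (C♭) -/

set_option synthInstance.maxHeartbeats 400000 in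
set_option maxHeartbeats 8000000 in
/-- **THE SOCKET IMPLIES THE LETTER: `CE ⟸ (C♭)`.**  Hypothesis = the registered (C♭) body `CohFinComponentIsThetaAdm` verbatim; conclusion = the
registered CE body `StubCELocalTypesTheta` with `IsLocalTypeAt` unfolded.  With ★ `F0P2cSocketCOfStubs.cohFinComponentIsThetaAdm_of_CE_CF_CI` and CF ★, CI ★
this makes CE ⟺ (C♭) on the floor.  Proof: keep `(μ, a, χ)`; at a finite place `v`, CI ★ + CL ★ give an irreducible local type `τ′` of `ω_H`; the
restriction of the injective intertwiner `σ → ω_H` along ★ `inclPlace v` makes `σ|_v` `τ′`-isotypic as well as `τ`-isotypic, so `τ ≃ τ′`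
(uniqueness of the isotypic type of the non-zero module `σ`), and `ω_H|_v` is `τ`-isotypic.
[cite: Bump1997, §3.4 Prop. 3.4.1 last bullet, Thm. 3.4.4] [cite: FlathCorvallis1979, Thm. 3 (uniqueness clause)]
[cite: Rogawski1990, Thm. 13.3.6 (c)] [cite: Liu2021, Def. 4.11, Rem. 4.14, App. D Lem. D.1] -/
theorem stubCE_of_cohFinComponentIsThetaAdm
    (hC :
      ∀ (L : Type) [Field L] [NumberField L] [IsCMField L] (ι : L →+* ℂ) (H : Matrix (Fin 3) (Fin 3) L) (T : GL (Fin 3) ℂ)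
        (hT : (T : Matrix (Fin 3) (Fin 3) ℂ)ᴴ * H.map ι * (T : Matrix (Fin 3) (Fin 3) ℂ) = Literature.Geometry.ComplexHyperbolic.BallModel.J),
        (∀ τ' : L →+* ℂ, InfinitePlace.mk τ' ≠ InfinitePlace.mk ι → (H.map τ').PosDef) → 2 ≤ Module.finrank ℚ ↥(maximalRealSubfield L) →
        ∀ {n' : ℕ} (e₁ : Fin 3 × Fin 1 ≃ Fin n') (dV : Fin 3 → L) (hdV : ∀ i, IsCMField.complexConj L (dV i) = dV i)
          (hdV0 : ∀ i, dV i ≠ 0) (g : GL (Fin 3) L),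
          ((g : Matrix (Fin 3) (Fin 3) L).map (cmConjRingHom L))ᵀ * H * (g : Matrix (Fin 3) (Fin 3) L) = Matrix.diagonal dV →
          ∀ (ιV : finAdelic (↥(maximalRealSubfield L)) L (IsCMField.complexConj L) 3 H →*
              finAdelic (↥(maximalRealSubfield L)) L (IsCMField.complexConj L) 3 (Matrix.diagonal dV)),
            (∀ k, ((ιV k : finAdelic (↥(maximalRealSubfield L)) L (IsCMField.complexConj L) 3 (Matrix.diagonal dV)) :
                GL (Fin 3) (FiniteAdeleRing (𝓞 L) L)) =
              (toFinAdeleGL L 3 g)⁻¹ * (k : GL (Fin 3) (FiniteAdeleRing (𝓞 L) L)) * toFinAdeleGL L 3 g) →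
            ∀ (μ : Measure (adelicGroupData (↥(maximalRealSubfield L)) L (IsCMField.complexConj L) 3 H).automorphicQuotient)
              [(adelicGroupData (↥(maximalRealSubfield L)) L (IsCMField.complexConj L) 3 H).IsAutomorphicMeasure μ]
              (W : Type) [AddCommGroup W] [Module ℂ W]
              (σ : Representation ℂ (finAdelic (↥(maximalRealSubfield L)) L (IsCMField.complexConj L) 3 H) W),
              σ.IsIrreducible → σ.IsSmooth → σ.IsAdmissible →
              ∀ P : DiscreteAutomorphicRep (adelicGroupData (↥(maximalRealSubfield L)) L (IsCMField.complexConj L) 3 H) μ,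
                (P.IsHolCotangentAt (cmArchSection L ι H T hT) (cmCompactFactor L ι H T hT) ∨
                  P.IsAntiholCotangentAt (cmArchSection L ι H T hT) (cmCompactFactor L ι H T hT)) →
                P.HasFinComponent σ →
                ∃ (μ : Literature.NumberTheory.Automorphic.IdeleClassGroup L →ₜ* Circle) (hμ : IsConjugateSymplectic L μ), HasWeight L μ 1 ∧
                  ∃ (a : (↥(maximalRealSubfield L))ˣ) (χ : Chi (↥(maximalRealSubfield L)) L (IsCMField.complexConj L)),
                    ∃ f : σ.IntertwiningMap
                      (rhoAtLine (↥(maximalRealSubfield L)) L (IsCMField.complexConj L) 3 e₁ (Matrix.diagonal dV)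
                      (complexConj_imagUnit L) (imagUnit_ne_zero L) (imagUnit_mul_self L) (realDiagonal_isSymm L dV hdV)
                      (isUnit_det_realDiagonal L dV hdV hdV0) (realDiagonal_map L dV hdV).symm
                      (fun a => isCompatible_chiSplittingLine L e₁ dV hdV hdV0 (toHeckeCharacter L μ)
                        (isUnitary_toHeckeCharacter L μ) ((isOscillatorChar_toHeckeCharacter_iff μ).mpr hμ)
                        (TW (↥(maximalRealSubfield L)) a) (isSymm_TW (↥(maximalRealSubfield L)) a)
                        (isUnit_det_TW (↥(maximalRealSubfield L)) a) (JW (↥(maximalRealSubfield L)) L a)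
                        (JW_eq (↥(maximalRealSubfield L)) L a)) ιV a χ),
                      Function.Injective f
) :
    ∀ (L : Type) [Field L] [NumberField L] [IsCMField L] (ι : L →+* ℂ) (H : Matrix (Fin 3) (Fin 3) L) (T : GL (Fin 3) ℂ)
      (hT : (T : Matrix (Fin 3) (Fin 3) ℂ)ᴴ * H.map ι * (T : Matrix (Fin 3) (Fin 3) ℂ) = Literature.Geometry.ComplexHyperbolic.BallModel.J),
      (∀ τ' : L →+* ℂ, InfinitePlace.mk τ' ≠ InfinitePlace.mk ι → (H.map τ').PosDef) → 2 ≤ Module.finrank ℚ ↥(maximalRealSubfield L) →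
      ∀ {n' : ℕ} (e₁ : Fin 3 × Fin 1 ≃ Fin n') (dV : Fin 3 → L) (hdV : ∀ i, IsCMField.complexConj L (dV i) = dV i)
        (hdV0 : ∀ i, dV i ≠ 0) (g : GL (Fin 3) L),
        ((g : Matrix (Fin 3) (Fin 3) L).map (cmConjRingHom L))ᵀ * H * (g : Matrix (Fin 3) (Fin 3) L) = Matrix.diagonal dV →
        ∀ (ιV : finAdelic (↥(maximalRealSubfield L)) L (IsCMField.complexConj L) 3 H →*
            finAdelic (↥(maximalRealSubfield L)) L (IsCMField.complexConj L) 3 (Matrix.diagonal dV)),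
          (∀ k, ((ιV k : finAdelic (↥(maximalRealSubfield L)) L (IsCMField.complexConj L) 3 (Matrix.diagonal dV)) :
              GL (Fin 3) (FiniteAdeleRing (𝓞 L) L)) =
            (toFinAdeleGL L 3 g)⁻¹ * (k : GL (Fin 3) (FiniteAdeleRing (𝓞 L) L)) * toFinAdeleGL L 3 g) →
          ∀ (μ : Measure (adelicGroupData (↥(maximalRealSubfield L)) L (IsCMField.complexConj L) 3 H).automorphicQuotient)
            [(adelicGroupData (↥(maximalRealSubfield L)) L (IsCMField.complexConj L) 3 H).IsAutomorphicMeasure μ]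
            (W : Type) [AddCommGroup W] [Module ℂ W]
            (σ : Representation ℂ (finAdelic (↥(maximalRealSubfield L)) L (IsCMField.complexConj L) 3 H) W),
            σ.IsIrreducible → σ.IsSmooth → σ.IsAdmissible →
            ∀ P : DiscreteAutomorphicRep (adelicGroupData (↥(maximalRealSubfield L)) L (IsCMField.complexConj L) 3 H) μ,
              (P.IsHolCotangentAt (cmArchSection L ι H T hT) (cmCompactFactor L ι H T hT) ∨
                P.IsAntiholCotangentAt (cmArchSection L ι H T hT) (cmCompactFactor L ι H T hT)) →
              P.HasFinComponent σ →
              ∃ (μ : Literature.NumberTheory.Automorphic.IdeleClassGroup L →ₜ* Circle) (hμ : IsConjugateSymplectic L μ), HasWeight L μ 1 ∧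
                ∃ (a : (↥(maximalRealSubfield L))ˣ) (χ : Chi (↥(maximalRealSubfield L)) L (IsCMField.complexConj L)),
                  ∀ (v : HeightOneSpectrum (𝓞 ↥(maximalRealSubfield L))) (Tv : Type) [AddCommGroup Tv] [Module ℂ Tv]
                    (τ : Representation ℂ (localPi L (IsCMField.complexConj L) 3 H v) Tv),
                    (τ.IsIrreducible ∧
                      isotypicComponent (MonoidAlgebra ℂ (localPi L (IsCMField.complexConj L) 3 H v))
                        (Representation.asModule (σ.comp (inclPlace (↥(maximalRealSubfield L)) L (IsCMField.complexConj L) 3 H v)))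
                        (Representation.asModule τ) = ⊤) →
                    (τ.IsIrreducible ∧
                      isotypicComponent (MonoidAlgebra ℂ (localPi L (IsCMField.complexConj L) 3 H v))
                        (Representation.asModule
                          ((rhoAtLine (↥(maximalRealSubfield L)) L (IsCMField.complexConj L) 3 e₁ (Matrix.diagonal dV)
                      (complexConj_imagUnit L) (imagUnit_ne_zero L) (imagUnit_mul_self L) (realDiagonal_isSymm L dV hdV)
                      (isUnit_det_realDiagonal L dV hdV hdV0) (realDiagonal_map L dV hdV).symm
                      (fun a => isCompatible_chiSplittingLine L e₁ dV hdV hdV0 (toHeckeCharacter L μ)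
                        (isUnitary_toHeckeCharacter L μ) ((isOscillatorChar_toHeckeCharacter_iff μ).mpr hμ)
                        (TW (↥(maximalRealSubfield L)) a) (isSymm_TW (↥(maximalRealSubfield L)) a)
                        (isUnit_det_TW (↥(maximalRealSubfield L)) a) (JW (↥(maximalRealSubfield L)) L a)
                        (JW_eq (↥(maximalRealSubfield L)) L a)) ιV a χ).comp
                            (inclPlace (↥(maximalRealSubfield L)) L (IsCMField.complexConj L) 3 H v)))
                        (Representation.asModule τ) = ⊤) := by
  intro L _ _ _ ι H T hT hdef h2 n' e₁ dV hdV hdV0 g hg ιV hιV μ _ W _ _ σ hirr hsm hadm P hP hfin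
  -- (C♭): the global datum and the injective intertwiner `f : σ → ω_H`
  obtain ⟨μ', hμ', hw, a, χ, f, hf⟩ := hC L ι H T hT hdef h2 e₁ dV hdV hdV0 g hg ιV hιV μ W σ hirr hsm hadm P hP hfin
  refine ⟨μ', hμ', hw, a, χ, ?_⟩
  intro v Tv _ _ τ hτ
  obtain ⟨hτirr, hτσ⟩ := hτ
  refine ⟨hτirr, ?_⟩
  -- CI ★: `ω_H` is irreducible and admissible
  obtain ⟨hωirr, hωadm⟩ := F0P2cStubCI.stubCI_holds L H e₁ dV hdV hdV0 g hg ιV hιV μ' hμ' hw a χ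
  -- CL ★ at `ω_H`: an irreducible local type `τ'` at `v`
  obtain ⟨T', _, _, τ', hτ'irr, hτ'ω⟩ :=
    F0P2cStubCLLocalTypeExists.stubCL_holds (↥(maximalRealSubfield L)) L (IsCMField.complexConj L) 3 H _ _ hωirr hωadm v
  haveI := hτirr
  haveI := hτ'irr
  haveI := hirr
  -- the intertwiner restricted along `inclPlace v`
  let fv : Representation.IntertwiningMap (σ.comp (inclPlace (↥(maximalRealSubfield L)) L (IsCMField.complexConj L) 3 H v))
      ((rhoAtLine (↥(maximalRealSubfield L)) L (IsCMField.complexConj L) 3 e₁ (Matrix.diagonal dV)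
        (complexConj_imagUnit L) (imagUnit_ne_zero L) (imagUnit_mul_self L) (realDiagonal_isSymm L dV hdV)
        (isUnit_det_realDiagonal L dV hdV hdV0) (realDiagonal_map L dV hdV).symm
        (fun a => isCompatible_chiSplittingLine L e₁ dV hdV hdV0 (toHeckeCharacter L μ')
          (isUnitary_toHeckeCharacter L μ') ((isOscillatorChar_toHeckeCharacter_iff μ').mpr hμ')
          (TW (↥(maximalRealSubfield L)) a) (isSymm_TW (↥(maximalRealSubfield L)) a)
          (isUnit_det_TW (↥(maximalRealSubfield L)) a) (JW (↥(maximalRealSubfield L)) L a)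
          (JW_eq (↥(maximalRealSubfield L)) L a)) ιV a χ).comp
        (inclPlace (↥(maximalRealSubfield L)) L (IsCMField.complexConj L) 3 H v)) :=
    LinearMap.intertwiningMap_of_isIntertwiningMap _ _ f.toLinearMap fun x w =>
      LinearMap.congr_fun (f.isIntertwining' (inclPlace (↥(maximalRealSubfield L)) L (IsCMField.complexConj L) 3 H v x)) w
  have hfv : Function.Injective fv := hf
  -- `σ|_v` is also `τ'`-isotypic (pull-back along the injective intertwiner)
  have hτ'σ := P2StubCFOfLocal.isotypicComponent_eq_top_of_injective τ' _ _ fv hfv hτ'ω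
  -- `σ ≠ 0`, so its isotypic type is unique: `τ ≃ τ'`
  haveI : Nontrivial (Representation.asModule
      (σ.comp (inclPlace (↥(maximalRealSubfield L)) L (IsCMField.complexConj L) 3 H v))) :=
    (IsSimpleModule.nontrivial (MonoidAlgebra ℂ (finAdelic (↥(maximalRealSubfield L)) L (IsCMField.complexConj L) 3 H))
      σ.asModule :)
  obtain ⟨e⟩ := nonempty_linearEquiv_of_isotypicComponent_eq_top hτσ hτ'σ (LinearEquiv.refl _ _)
  -- transport the `τ'`-isotypy of `ω_H|_v` to `τ`
  rw [e.isotypicComponent_eq]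
  exact hτ'ω

/-! ## §2  CE ⟸ (C) -/

set_option synthInstance.maxHeartbeats 400000 in
set_option maxHeartbeats 8000000 in
/-- **CE from the Literature socket (C) `Rogawski1990.cohFinComponent_isTheta` itself**: (C) ⇒ (C♭) (drop the admissibility binder) ⇒ CE.
[cite: Rogawski1990, Thm. 13.3.6 (c)] [cite: FlathCorvallis1979, Thm. 3 (uniqueness clause)] [cite: Bump1997, §3.4 Prop. 3.4.1] -/
theorem stubCE_of_cohFinComponent_isTheta (hC : Literature.NumberTheory.Rogawski1990.cohFinComponent_isTheta) :
    ∀ (L : Type) [Field L] [NumberField L] [IsCMField L] (ι : L →+* ℂ) (H : Matrix (Fin 3) (Fin 3) L) (T : GL (Fin 3) ℂ)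
      (hT : (T : Matrix (Fin 3) (Fin 3) ℂ)ᴴ * H.map ι * (T : Matrix (Fin 3) (Fin 3) ℂ) = Literature.Geometry.ComplexHyperbolic.BallModel.J),
      (∀ τ' : L →+* ℂ, InfinitePlace.mk τ' ≠ InfinitePlace.mk ι → (H.map τ').PosDef) → 2 ≤ Module.finrank ℚ ↥(maximalRealSubfield L) →
      ∀ {n' : ℕ} (e₁ : Fin 3 × Fin 1 ≃ Fin n') (dV : Fin 3 → L) (hdV : ∀ i, IsCMField.complexConj L (dV i) = dV i)
        (hdV0 : ∀ i, dV i ≠ 0) (g : GL (Fin 3) L),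
        ((g : Matrix (Fin 3) (Fin 3) L).map (cmConjRingHom L))ᵀ * H * (g : Matrix (Fin 3) (Fin 3) L) = Matrix.diagonal dV →
        ∀ (ιV : finAdelic (↥(maximalRealSubfield L)) L (IsCMField.complexConj L) 3 H →*
            finAdelic (↥(maximalRealSubfield L)) L (IsCMField.complexConj L) 3 (Matrix.diagonal dV)),
          (∀ k, ((ιV k : finAdelic (↥(maximalRealSubfield L)) L (IsCMField.complexConj L) 3 (Matrix.diagonal dV)) :
              GL (Fin 3) (FiniteAdeleRing (𝓞 L) L)) =
            (toFinAdeleGL L 3 g)⁻¹ * (k : GL (Fin 3) (FiniteAdeleRing (𝓞 L) L)) * toFinAdeleGL L 3 g) →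
          ∀ (μ : Measure (adelicGroupData (↥(maximalRealSubfield L)) L (IsCMField.complexConj L) 3 H).automorphicQuotient)
            [(adelicGroupData (↥(maximalRealSubfield L)) L (IsCMField.complexConj L) 3 H).IsAutomorphicMeasure μ]
            (W : Type) [AddCommGroup W] [Module ℂ W]
            (σ : Representation ℂ (finAdelic (↥(maximalRealSubfield L)) L (IsCMField.complexConj L) 3 H) W),
            σ.IsIrreducible → σ.IsSmooth → σ.IsAdmissible →
            ∀ P : DiscreteAutomorphicRep (adelicGroupData (↥(maximalRealSubfield L)) L (IsCMField.complexConj L) 3 H) μ,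
              (P.IsHolCotangentAt (cmArchSection L ι H T hT) (cmCompactFactor L ι H T hT) ∨
                P.IsAntiholCotangentAt (cmArchSection L ι H T hT) (cmCompactFactor L ι H T hT)) →
              P.HasFinComponent σ →
              ∃ (μ : Literature.NumberTheory.Automorphic.IdeleClassGroup L →ₜ* Circle) (hμ : IsConjugateSymplectic L μ), HasWeight L μ 1 ∧
                ∃ (a : (↥(maximalRealSubfield L))ˣ) (χ : Chi (↥(maximalRealSubfield L)) L (IsCMField.complexConj L)),
                  ∀ (v : HeightOneSpectrum (𝓞 ↥(maximalRealSubfield L))) (Tv : Type) [AddCommGroup Tv] [Module ℂ Tv]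
                    (τ : Representation ℂ (localPi L (IsCMField.complexConj L) 3 H v) Tv),
                    (τ.IsIrreducible ∧
                      isotypicComponent (MonoidAlgebra ℂ (localPi L (IsCMField.complexConj L) 3 H v))
                        (Representation.asModule (σ.comp (inclPlace (↥(maximalRealSubfield L)) L (IsCMField.complexConj L) 3 H v)))
                        (Representation.asModule τ) = ⊤) →
                    (τ.IsIrreducible ∧
                      isotypicComponent (MonoidAlgebra ℂ (localPi L (IsCMField.complexConj L) 3 H v))
                        (Representation.asModule
                          ((rhoAtLine (↥(maximalRealSubfield L)) L (IsCMField.complexConj L) 3 e₁ (Matrix.diagonal dV)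
                      (complexConj_imagUnit L) (imagUnit_ne_zero L) (imagUnit_mul_self L) (realDiagonal_isSymm L dV hdV)
                      (isUnit_det_realDiagonal L dV hdV hdV0) (realDiagonal_map L dV hdV).symm
                      (fun a => isCompatible_chiSplittingLine L e₁ dV hdV hdV0 (toHeckeCharacter L μ)
                        (isUnitary_toHeckeCharacter L μ) ((isOscillatorChar_toHeckeCharacter_iff μ).mpr hμ)
                        (TW (↥(maximalRealSubfield L)) a) (isSymm_TW (↥(maximalRealSubfield L)) a)
                        (isUnit_det_TW (↥(maximalRealSubfield L)) a) (JW (↥(maximalRealSubfield L)) L a)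
                        (JW_eq (↥(maximalRealSubfield L)) L a)) ιV a χ).comp
                            (inclPlace (↥(maximalRealSubfield L)) L (IsCMField.complexConj L) 3 H v)))
                        (Representation.asModule τ) = ⊤) :=
  stubCE_of_cohFinComponentIsThetaAdm
    fun L _ _ _ ι H T hT hdef h2 _ e₁ dV hdV hdV0 g hg ιV hιV μ _ W _ _ σ hirr hsm _ P hP hfin =>
      hC L ι H T hT hdef h2 e₁ dV hdV hdV0 g hg ιV hιV μ W σ hirr hsm P hP hfin

end Summit.HodgeConjecture.HodgeConjecture.Cruxes.H413.F0P2cStubCEOfSocketCadm
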